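import Summits.Parity.GeneralizedHardyLittlewood.Theorems.PrimeLevelFamEdgeIdeaDeltasFamilyDefs
import Literature.NumberTheory.LFunctions.HeckeLandauPageLowerBound
import Literature.NumberTheory.LFunctions.Zhang2022.TypedSection01and02A
import Literature.Barriers.Parity.SiegelZeroDichotomyNoSiegelZeros
import HarnessLib

/-!
# Route `PrimeLevelFamEdge` — TYPED IDEA DELTAS, deck 14a: `negation` lens — the PAGE-SCALE and the
# DEPTH-MATCHED (A)-world kills of level-free K_A (cell ls-idea, seat ls-idea-lens-20 gen 1, card K-L20-1
# «THE PRETENTIOUS TABLE AND THE KILL THAT IS ALREADY rh.S34», §1/§1b of the seat's `Sketch_L20_Negation.lean`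
# sha16 0527856a79077ff6; LANDING NOTE typer ls-idea-typ-1 gen 2: VERBATIM up to (i) namespace `.L20` →
# `.Negation`, (ii) the 0-ary `EventualLOneNormLowerBound` made PARAMETRIC in the log-exponent `A` (the
# seat's chain uses `A = 1`; `lOneLowerBound_of_eventuallyNotWorldA` then follows from the norm form), (iii) the
# file split 14a (§1, §1b, §1c) / 14b (§2, §3) for the 400-line rule, (iv) §1c = critic E's `deepKill_of_kill`.)

Negation-construct on crux K_A = `MomentsBeyondDiagonal` (stmt-Parity-20007) of `route-Parity-PrimeLevelFamEdge`.

§1  PAGE-SCALE READING OF K6-3 (b): `AWorldKillsLevelFreeKA η₀` (deck 2 §5) at a FIXED quality `η₀ ≥ 10` is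
    «real zeros of quality ≥ η₀ at arbitrarily large conductors refute level-free K_A»; KERNEL
    `AWorldKillsLevelFreeKA η₀ → MomentsBeyondDiagonal → Zhang2022.Skeleton.Theorem1` (eventual Page-scale
    zero-free interval ⇒ Hecke–Landau–Page `‖L(1,χ)‖ ≥ c₂/(η₀ log D)`, tree `heckeLandauPageLB_scale` ⇒
    `LOneLowerBound 1`), and at ANY quality through rh.S34 (`noSiegelZeros_of_kA_of_kill`).
§1b THE DEPTH-MATCHED KILL `DeepAWorldKillsKA A` (worlds `‖L(1,χ_D)‖ ≤ (log D)^{−A}` i.o. refute K_A): KERNEL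
    `DeepAWorldKillsKA A → MomentsBeyondDiagonal → LOneLowerBound A` (hence `Theorem1` for `A ≤ 2022`).
§1c THE LADDER DIRECTION (critic E): `deepKill_of_kill : 10 ≤ η₀ → 2 ≤ A → AWorldKillsLevelFreeKA η₀ →
    DeepAWorldKillsKA A` — the fixed-quality kill is the strongest, `DeepAWorldKillsKA 2022` the weakest.

HONESTY: Props + KERNEL GLUE ONLY — no analytic input is proved here; both kill hypotheses and K_A are OPEN;
no summit statement, no exceptional-zero theorem (no Landau–Siegel / Siegel-zero exclusion, no Theorem 1–2 of
arXiv:2211.02515, no repaired Margin232) is proved by this file; typed ≠ proved.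
-/

noncomputable section

open scoped MatrixGroups Real
open CongruenceSubgroup Complex Finset Filter Polynomial
open Literature.NumberTheory.EllipticCurves.ModularForms
open Literature.NumberTheory.LFunctions
open Literature.NumberTheory.LFunctions.KMV2000
open Summit.Parity.GeneralizedHardyLittlewood.Theses.PrimeLevelFamEdge
open Summit.Parity.GeneralizedHardyLittlewood.Theorems.PrimeLevelFamEdgeIdeaDeltas

namespace Summit.Parity.GeneralizedHardyLittlewood.Theorems.PrimeLevelFamEdgeIdeaDeltas.Negation

/-! ## §1 Page-scale reading of K6-3 (b): kernel chain `K_A ∧ kill(η₀) ⊢ Theorem1` -/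

/-- «Eventually no real zero of quality `≥ η₀`»: for all large conductors `q`, no Dirichlet character
mod `q` carries a Siegel zero (tree sense: primitive, quadratic, zero at `1 − 1/(η log q)`) of any
quality `η ≥ η₀`.  For `η₀ = 10` this is an eventual PAGE-SCALE zero-free interval. -/
def EventuallyNoQualityZeros (η₀ : ℝ) : Prop :=
  ∃ q₀ : ℕ, ∀ (q : ℕ) [NeZero q] (χ : DirichletCharacter ℂ q) (η : ℝ),
    q₀ ≤ q → η₀ ≤ η → ¬ Literature.Barriers.Parity.IsSiegelZero χ η

/-- KERNEL: the contrapositive of K6-3 (b) at quality `η₀`, pushed through the quantifiers: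
`AWorldKillsLevelFreeKA η₀ ∧ K_A ⇒` eventually no real zero of quality `≥ η₀`. -/
theorem eventuallyNoQualityZeros_of_kA {η₀ : ℝ} (h : AWorldKillsLevelFreeKA η₀)
    (hA : MomentsBeyondDiagonal) : EventuallyNoQualityZeros η₀ := by
  have key := not_frequently_siegelZero_of_kA h hA
  by_contra hne
  apply key
  intro q₀
  by_contra hq
  apply hne
  refine ⟨q₀, fun q _ χ η hq₀ hη hS ↦ hq ⟨q, ‹NeZero q›, χ, η, hq₀, hη, hS⟩⟩

/-- «Eventual Page-scale zero-free interval»: for all large `q`, every real primitive `χ mod q` has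
`L(σ, χ) ≠ 0` on `[1 − 1/(η₀ log q), 1)`. -/
def EventualPageZeroFree (η₀ : ℝ) : Prop :=
  ∃ q₀ : ℕ, ∀ (q : ℕ) [NeZero q] (χ : DirichletCharacter ℂ q), q₀ ≤ q →
    χ.IsPrimitive → MulChar.IsQuadratic χ →
      ∀ σ : ℝ, 1 - 1 / (η₀ * Real.log q) ≤ σ → σ < 1 → χ.LFunction σ ≠ 0

/-- KERNEL: a real zero `σ ∈ [1 − 1/(η₀ log q), 1)` of a real primitive `χ` IS a Siegel zero of
quality `η = 1/((1−σ) log q) ≥ η₀` (for `η₀ ≥ 10`, `q ≥ 2`), so «eventually no quality-≥η₀ zeros»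
is an eventual Page-scale zero-free interval. -/
theorem eventualPageZeroFree_of_noQualityZeros {η₀ : ℝ} (hη : 10 ≤ η₀)
    (h : EventuallyNoQualityZeros η₀) : EventualPageZeroFree η₀ := by
  obtain ⟨q₀, hq₀⟩ := h
  refine ⟨max q₀ 2, fun q _ χ hq hprim hquad σ hlo hhi hzero ↦ ?_⟩
  have hq2 : (2 : ℝ) ≤ q := by exact_mod_cast le_trans (le_max_right _ _) hq
  have hlog : 0 < Real.log q := Real.log_pos (by linarith)
  have hη0 : 0 < η₀ := by linarith
  have h1σ : 0 < 1 - σ := by linarith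
  -- the quality of the zero `σ`
  set η : ℝ := 1 / ((1 - σ) * Real.log q) with hηdef
  have hηpos : 0 < (1 - σ) * Real.log q := mul_pos h1σ hlog
  have hσeq : 1 - 1 / (η * Real.log q) = σ := by
    rw [hηdef]
    field_simp
    ring
  have hηge : η₀ ≤ η := by
    -- from `1 − 1/(η₀ log q) ≤ σ`: `(1 − σ) η₀ log q ≤ 1`
    rw [hηdef, le_div_iff₀ hηpos]
    have hden : 0 < η₀ * Real.log q := mul_pos hη0 hlog
    have : 1 - σ ≤ 1 / (η₀ * Real.log q) := by linarith
    rw [le_div_iff₀ hden] at this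
    linarith
  have hS : Literature.Barriers.Parity.IsSiegelZero χ η := by
    refine ⟨hprim, hquad, le_trans hη hηge, ?_⟩
    rw [hσeq]
    exact hzero
  exact hq₀ q χ η (le_trans (le_max_left _ _) hq) hηge hS

/-- «Eventual lower bound `‖L(1,χ)‖ ≥ c/(log D)^A`» for real primitive `χ mod D`, `D ≥ D₀` (norm form;
PARAMETRIC in the exponent `A` — the seat's chain uses `A = 1`; cf. the tree's real-part form
`CentralValueFamilyHalfEdge.EventualLOneLowerBound A`). -/
def EventualLOneNormLowerBound (A : ℕ) : Prop :=
  ∃ c : ℝ, 0 < c ∧ ∃ D₀ : ℕ, ∀ (D : ℕ) [NeZero D] (χ : DirichletCharacter ℂ D), D₀ ≤ D →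
    χ.IsPrimitive → MulChar.IsQuadratic χ → c / Real.log D ^ A ≤ ‖χ.LFunction 1‖

/-- KERNEL: eventual Page-scale zero-freeness ⇒ eventual `‖L(1,χ)‖ ≥ (c₂/η₀)/log D`, by the tree's
PROVED Hecke–Landau–Page resolution form `heckeLandauPageLB_scale` (MV I Thm. 11.4). -/
theorem eventualLOneNorm_of_pageZeroFree {η₀ : ℝ} (hη : 0 < η₀) (h : EventualPageZeroFree η₀) :
    EventualLOneNormLowerBound 1 := by
  obtain ⟨q₀, hq₀⟩ := h
  obtain ⟨c₂, hc₂, H⟩ := heckeLandauPageLB_scale (η₀ := 1 / η₀) (by positivity)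
  refine ⟨c₂ / η₀, by positivity, max q₀ 3, fun D _ χ hD hprim hquad ↦ ?_⟩
  have hD3 : 3 ≤ D := le_trans (le_max_right _ _) hD
  have hD3' : (3 : ℝ) ≤ D := by exact_mod_cast hD3
  have hlog : 0 < Real.log D := Real.log_pos (by linarith)
  have hne : χ ≠ 1 := Zhang2022.Skeleton.ne_one_of_isPrimitive_of_three_le hprim hD3
  set θ : ℝ := 1 / (η₀ * Real.log D) with hθ
  have hθpos : 0 < θ := by rw [hθ]; positivity
  have hscale : θ * Real.log D ≤ 1 / η₀ := by
    rw [hθ]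
    field_simp
    rfl
  have hzf : ∀ σ : ℝ, 1 - θ ≤ σ → σ < 1 → χ.LFunction σ ≠ 0 :=
    fun σ h1 h2 ↦ hq₀ D χ (le_trans (le_max_left _ _) hD) hprim hquad σ (by rw [hθ] at h1; exact h1) h2
  have key := H D χ hD3 hne θ hθpos hscale hzf
  calc c₂ / η₀ / Real.log D ^ 1 = c₂ * θ := by rw [pow_one, hθ]; field_simp
    _ ≤ ‖χ.LFunction 1‖ := key

/-- On a finite index type a pointwise-positive real function is bounded below by a positive
constant, strictly. [folklore] -/
private theorem exists_pos_lt_of_finite {ι : Type*} [Finite ι] (f : ι → ℝ) (hf : ∀ i, 0 < f i) :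
    ∃ c : ℝ, 0 < c ∧ ∀ i, c < f i := by
  cases isEmpty_or_nonempty ι with
  | inl h => exact ⟨1, one_pos, fun i => (IsEmpty.false i).elim⟩
  | inr h =>
    obtain ⟨i₀, hi₀⟩ := Finite.exists_min f
    exact ⟨f i₀ / 2, by linarith [hf i₀], fun i => by linarith [hf i₀, hi₀ i]⟩

/-- KERNEL: «for all large `D`» costs nothing (norm form, any exponent `A`): the finitely many nonprincipal
characters to moduli `3 ≤ D < D₀` have `L(1,χ) ≠ 0` (Dirichlet), so a smaller constant serves them.
(Same bookkeeping as `lOneLowerBound_of_eventual`.) -/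
theorem lOneLowerBound_of_eventualNorm {A : ℕ} (h : EventualLOneNormLowerBound A) :
    Zhang2022.Skeleton.LOneLowerBound A := by
  obtain ⟨c, hc, D₀, hD₀⟩ := h
  let ι := (e : Fin D₀) × {χ : DirichletCharacter ℂ ((e : ℕ) + 3) // χ ≠ 1}
  let f : ι → ℝ := fun i => ‖i.2.1.LFunction 1‖ * Real.log (((i.1 : ℕ) + 3 : ℕ) : ℝ) ^ A
  have hf : ∀ i, 0 < f i := by
    rintro ⟨e, χ, hχ⟩
    have h3 : (3 : ℝ) ≤ (((e : ℕ) + 3 : ℕ) : ℝ) := by exact_mod_cast (by omega : 3 ≤ (e : ℕ) + 3)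
    have hlog : 0 < Real.log ((((e : ℕ) + 3 : ℕ) : ℝ)) := Real.log_pos (by linarith)
    have hL : χ.LFunction 1 ≠ 0 :=
      DirichletCharacter.LFunction_ne_zero_of_one_le_re χ (Or.inl hχ) (by simp)
    exact mul_pos (norm_pos_iff.mpr hL) (pow_pos hlog _)
  obtain ⟨c', hc', hcf⟩ := exists_pos_lt_of_finite f hf
  refine ⟨min (c / 2) c', lt_min (by linarith) hc', fun D _ χ hD hquad hprim => ?_⟩
  have hD3' : (3 : ℝ) ≤ D := by exact_mod_cast hD
  have hlog : 0 < Real.log D := Real.log_pos (by linarith)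
  have hpow : 0 < Real.log D ^ A := pow_pos hlog _
  by_cases hlarge : D₀ ≤ D
  · have hA := hD₀ D χ hlarge hprim hquad
    calc min (c / 2) c' / Real.log D ^ A ≤ (c / 2) / Real.log D ^ A :=
          div_le_div_of_nonneg_right (min_le_left _ _) hpow.le
      _ < c / Real.log D ^ A := div_lt_div_of_pos_right (by linarith) hpow
      _ ≤ ‖χ.LFunction 1‖ := hA
  · push Not at hlarge
    obtain ⟨e, rfl⟩ : ∃ e : ℕ, D = e + 3 := ⟨D - 3, by omega⟩
    have he : e < D₀ := by omega
    have hne : χ ≠ 1 := Zhang2022.Skeleton.ne_one_of_isPrimitive_of_three_le hprim hD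
    have key := hcf ⟨⟨e, he⟩, ⟨χ, hne⟩⟩
    simp only [f] at key
    calc min (c / 2) c' / Real.log ((e + 3 : ℕ) : ℝ) ^ A
        ≤ c' / Real.log ((e + 3 : ℕ) : ℝ) ^ A :=
          div_le_div_of_nonneg_right (min_le_right _ _) hpow.le
      _ < ‖χ.LFunction 1‖ := by rwa [div_lt_iff₀ hpow]

/-- **KERNEL HEADLINE (lens-20): at any fixed quality `η₀ ≥ 10`, the (A)-world kill of level-free
K_A makes K_A ALONE imply the route's leaf.**  `AWorldKillsLevelFreeKA η₀ → MomentsBeyondDiagonal →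
Zhang2022.Skeleton.Theorem1` — no K_B, no twisted half, no mixed moment, no Petersson bound.
Both hypotheses are OPEN; typed ≠ proved.  The card K-L20-1 argues the first holds at formal
main-term grade for every `η₀ ≥ 10` (not only as `η₀ → ∞`). -/
theorem theorem1_of_kA_of_pageKill {η₀ : ℝ} (hη : 10 ≤ η₀) (hK : AWorldKillsLevelFreeKA η₀)
    (hA : MomentsBeyondDiagonal) : Zhang2022.Skeleton.Theorem1 :=
  Zhang2022.Section1.lOneLowerBound_mono (by norm_num)
    (lOneLowerBound_of_eventualNorm
      (eventualLOneNorm_of_pageZeroFree (by linarith)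
        (eventualPageZeroFree_of_noQualityZeros hη (eventuallyNoQualityZeros_of_kA hK hA))))

/-- The same with the conclusion `LOneLowerBound 1` (`L(1,χ) ≫ 1/log D` for ALL real primitive χ,
`D ≥ 3`) — strictly above the leaf `Theorem1 = LOneLowerBound 2022` in the exponent. -/
theorem lOneLowerBound_one_of_kA_of_pageKill {η₀ : ℝ} (hη : 10 ≤ η₀)
    (hK : AWorldKillsLevelFreeKA η₀) (hA : MomentsBeyondDiagonal) :
    Zhang2022.Skeleton.LOneLowerBound 1 :=
  lOneLowerBound_of_eventualNorm
    (eventualLOneNorm_of_pageZeroFree (by linarith)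
      (eventualPageZeroFree_of_noQualityZeros hη (eventuallyNoQualityZeros_of_kA hK hA)))

/-- KERNEL CROSS-CHECK through the tree's own bridges: at ANY quality `η₀` (no `η₀ ≥ 10` needed),
`AWorldKillsLevelFreeKA η₀ ∧ K_A ⊢ ¬UnboundedSiegelZeros ⊢ NoSiegelZeros` (rh.S34; tree:
`noSiegelZeros_of_not_unboundedSiegelZeros`, PROVED) `⊢ LOneLowerBound 1` (`Zhang2022.Section1.eq11Imp_holds`,
PROVED) `⊢ Theorem1`.  So the FamilyDefs §5 reading «a level-free K_A proved would refute
`UnboundedSiegelZeros`» already says «K_A ⊢ rh.S34 ⊢ the route's leaf» once the kill holds at one quality. -/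
theorem noSiegelZeros_of_kA_of_kill {η₀ : ℝ} (hK : AWorldKillsLevelFreeKA η₀)
    (hA : MomentsBeyondDiagonal) : NoSiegelZeros :=
  Literature.Barriers.Parity.noSiegelZeros_of_not_unboundedSiegelZeros
    (fun hU ↦ not_frequently_siegelZero_of_kA hK hA
      ((unboundedSiegelZeros_iff_forall_antecedent.1 hU) η₀))

/-- KERNEL: … hence `Theorem1` from K_A and the kill at any one quality, through rh.S34. -/
theorem theorem1_of_kA_of_kill {η₀ : ℝ} (hK : AWorldKillsLevelFreeKA η₀)
    (hA : MomentsBeyondDiagonal) : Zhang2022.Skeleton.Theorem1 :=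
  Zhang2022.Section1.lOneLowerBound_mono (by norm_num)
    (Zhang2022.Section1.eq11Imp_holds (noSiegelZeros_of_kA_of_kill hK hA))

/-! ### §1b The DEPTH-MATCHED kill (what the cell's recipe actually supports) -/

/-- «Eventual lower bound `‖L(1,χ)‖ > (log D)^{−A}`» for real primitive `χ mod D`, `D ≥ D₀` — the
literal negation of «world (A)_A infinitely often». -/
def EventuallyNotWorldA (A : ℕ) : Prop :=
  ∃ D₀ : ℕ, ∀ (D : ℕ) [NeZero D] (χ : DirichletCharacter ℂ D), D₀ ≤ D →
    χ.IsPrimitive → MulChar.IsQuadratic χ → (Real.log D ^ A)⁻¹ < ‖χ.LFunction 1‖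

/-- **The depth-matched kill** `DeepAWorldKillsKA A`: «world (A)_A infinitely often — real primitive
`χ_D` with `‖L(1,χ_D)‖ ≤ (log D)^{−A}` at arbitrarily large `D` — refutes level-free K_A».  THIS is the
grade at which the cell's (A)-recipes live: K5-8's plateau law / K6-3 / BN-11 (b) are derived in
`L(1,χ_D) ≤ (log D)^{−A'}` worlds (lacunarity), and Bui–Pratt–Zaharescu's theorem-grade (A)-world
moments at prime level need `L(1,ψ) ≤ (log D)^{−50}` (JLMS 2023 Thm 1.1/1.2).  LADDER (v1.1, reconciled
with critic E P-E1-1): the FIXED-QUALITY kill is the STRONGEST claim and IMPLIES every depth-matched kill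
— `deepKill_of_kill (10 ≤ η₀) (2 ≤ A) : AWorldKillsLevelFreeKA η₀ → DeepAWorldKillsKA A` (§1c below,
PROVED by critic ls-idea-ref-5, `L20_probe_RefE.lean`, evidence #26 on stmt-Parity-20007) from
`heckeLandauPageLB_scale` read contrapositively (a world-(A)_A character at a large modulus carries a real
zero of quality `≥ η₀`); and the depth family is ANTITONE in its strength: `DeepAWorldKillsKA A →
DeepAWorldKillsKA B` for `A ≤ B` (`DeepAWorldKillsKA.mono_depth` below, proved), so `DeepAWorldKillsKA 2022`
is the WEAKEST kill and the CHEAPEST certificate for «K_A ≥ leaf» (critic E P-E1-2); `DeepAWorldKillsKA 50`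
certifies «K_A ≥ LOneLowerBound 50»; the fixed-quality kill certifies «K_A ≥ rh.S34».  NOT ASSERTED;
typed ≠ proved. -/
def DeepAWorldKillsKA (A : ℕ) : Prop :=
  (∀ D₀ : ℕ, ∃ (D : ℕ) (_ : NeZero D) (χ : DirichletCharacter ℂ D), D₀ ≤ D ∧
      χ.IsPrimitive ∧ MulChar.IsQuadratic χ ∧ ‖χ.LFunction 1‖ ≤ (Real.log D ^ A)⁻¹) →
    ¬ MomentsBeyondDiagonal

/-- KERNEL: the depth-matched kill and K_A give «eventually not world (A)_A». -/
theorem eventuallyNotWorldA_of_kA {A : ℕ} (hK : DeepAWorldKillsKA A) (hA : MomentsBeyondDiagonal) :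
    EventuallyNotWorldA A := by
  by_contra hne
  apply hK _ hA
  intro D₀
  by_contra hD
  apply hne
  refine ⟨D₀, fun D _ χ hD₀ hprim hquad ↦ ?_⟩
  by_contra hle
  push Not at hle
  exact hD ⟨D, ‹NeZero D›, χ, hD₀, hprim, hquad, hle⟩

/-- KERNEL: «eventually not world (A)_A» is the eventual norm lower bound at exponent `A` with constant
`c = 1` (typer's bookkeeping, enabled by the parametric `EventualLOneNormLowerBound A`). -/
theorem eventualLOneNorm_of_eventuallyNotWorldA {A : ℕ} (h : EventuallyNotWorldA A) :
    EventualLOneNormLowerBound A := by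
  obtain ⟨D₀, hD₀⟩ := h
  refine ⟨1, one_pos, D₀, fun D _ χ hD hprim hquad ↦ ?_⟩
  rw [one_div]
  exact (hD₀ D χ hD hprim hquad).le

/-- KERNEL: «eventually not world (A)_A» ⇒ `LOneLowerBound A` (all `D ≥ 3`; the finitely many small
moduli by Dirichlet's `L(1,χ) ≠ 0`, same bookkeeping as `lOneLowerBound_of_eventual`). -/
theorem lOneLowerBound_of_eventuallyNotWorldA {A : ℕ} (h : EventuallyNotWorldA A) :
    Zhang2022.Skeleton.LOneLowerBound A :=
  lOneLowerBound_of_eventualNorm (eventualLOneNorm_of_eventuallyNotWorldA h)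

/-- **KERNEL HEADLINE, depth-matched form: `DeepAWorldKillsKA A → MomentsBeyondDiagonal →
LOneLowerBound A`, hence `Theorem1` whenever the recipe's lacunarity depth `A ≤ 2022`** (BPZ-grade:
`A = 50`).  K_A ALONE is above the leaf at exactly the grade at which the cell holds PIN P-R1′ /
BN-11 (b); the number to watch is the depth `A` the kill's proof needs. -/
theorem lOneLowerBound_of_kA_of_deepKill {A : ℕ} (hK : DeepAWorldKillsKA A)
    (hA : MomentsBeyondDiagonal) : Zhang2022.Skeleton.LOneLowerBound A :=
  lOneLowerBound_of_eventuallyNotWorldA (eventuallyNotWorldA_of_kA hK hA)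

/-- … and the leaf, for any depth `A ≤ 2022`. -/
theorem theorem1_of_kA_of_deepKill {A : ℕ} (hA2022 : A ≤ 2022) (hK : DeepAWorldKillsKA A)
    (hA : MomentsBeyondDiagonal) : Zhang2022.Skeleton.Theorem1 :=
  Zhang2022.Section1.lOneLowerBound_mono hA2022 (lOneLowerBound_of_kA_of_deepKill hK hA)

/-- Bookkeeping (proved, critic E P-E1-2): the depth family is ANTITONE in strength — a kill at depth
`A` gives the kill at every depth `B ≥ A` (a deeper world is a smaller world: `(log D ^ B)⁻¹ ≤ (log D ^ A)⁻¹`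
once `log D ≥ 1`, which holds for `D ≥ 3`; small `D` are discarded by raising `D₀`).  Hence
`DeepAWorldKillsKA 2022` is the weakest member that still puts K_A above the leaf. -/
theorem DeepAWorldKillsKA.mono_depth {A B : ℕ} (h : DeepAWorldKillsKA A) (hAB : A ≤ B) :
    DeepAWorldKillsKA B := by
  intro hW
  refine h (fun D₀ ↦ ?_)
  obtain ⟨D, hD, χ, hD₀, hprim, hquad, hle⟩ := hW (max D₀ 3)
  refine ⟨D, hD, χ, le_trans (le_max_left _ _) hD₀, hprim, hquad, le_trans hle ?_⟩
  have hD3 : (3 : ℝ) ≤ D := by exact_mod_cast le_trans (le_max_right _ _) hD₀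
  have hlog : 1 ≤ Real.log D := by
    rw [← Real.log_exp 1]
    refine Real.log_le_log (Real.exp_pos 1) (le_trans ?_ hD3)
    have := Real.exp_one_lt_d9
    linarith
  have hpos : 0 < Real.log D ^ A := pow_pos (by linarith) _
  exact inv_anti₀ hpos (pow_le_pow_right₀ hlog hAB)

/-- Bookkeeping (proved): the fixed-quality kill family is MONOTONE — smaller threshold `η₀` = stronger
kill: for `η₀ ≤ η₀'` the antecedent at `η₀'` (zeros of quality `≥ η₀'` infinitely often) implies the
antecedent at `η₀`, so `AWorldKillsLevelFreeKA η₀ → AWorldKillsLevelFreeKA η₀'`.  The comparison with the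
depth family is `deepKill_of_kill` (§1c, critic E, proved: fixed quality ⇒ every depth `A ≥ 2`). -/
theorem AWorldKillsLevelFreeKA.mono {η₀ η₀' : ℝ} (h : AWorldKillsLevelFreeKA η₀) (hη : η₀ ≤ η₀') :
    AWorldKillsLevelFreeKA η₀' := by
  intro hS
  refine h (fun q₀ ↦ ?_)
  obtain ⟨q, hq, χ, η, hq₀, hη₀, hz⟩ := hS q₀
  exact ⟨q, hq, χ, η, hq₀, le_trans hη hη₀, hz⟩

/-! ### §1c The ladder direction (critic E, REF-E b1 P-E1-1; `L20_probe_RefE.lean` sha16 cd0028ab097be5e8 VERBATIM):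
fixed quality ⇒ every depth -/

/-- KERNEL (critic ls-idea-ref-5): the FIXED-QUALITY kill implies the DEPTH-MATCHED kill for every `A ≥ 2`
(and `η₀ ≥ 10`), by the contrapositive of the tree's PROVED Hecke–Landau–Page bound `heckeLandauPageLB_scale`:
`‖L(1,χ_D)‖ ≤ (log D)^{−A}` at large `D` forces a real zero in `[1 − 1/(η₀ log D), 1)`, i.e. a Siegel zero of
quality `≥ η₀`.  So «kill(η₀) ⇒ DeepKill(A)» IS automatic; the non-automatic direction is the converse.  The
leaf needs only the WEAKEST Prop `DeepAWorldKillsKA 2022`. -/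
theorem deepKill_of_kill {η₀ : ℝ} (hη : 10 ≤ η₀) {A : ℕ} (hA : 2 ≤ A)
    (hK : AWorldKillsLevelFreeKA η₀) : DeepAWorldKillsKA A := by
  intro hW hKA
  refine hK (fun q₀ ↦ ?_) hKA
  have hη0 : 0 < η₀ := by linarith
  obtain ⟨c₂, hc₂, H⟩ := heckeLandauPageLB_scale (η₀ := 1 / η₀) (by positivity)
  -- a threshold beyond which `(log D)^{-A} < c₂ /(η₀ log D)`
  obtain ⟨N, hN⟩ := exists_nat_gt (Real.exp (η₀ / c₂))
  obtain ⟨D, _, χ, hD, hprim, hquad, hL⟩ := hW (max q₀ (max 3 N))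
  have hDq₀ : q₀ ≤ D := le_trans (le_max_left _ _) hD
  have hD3 : 3 ≤ D := le_trans (le_trans (le_max_left _ _) (le_max_right _ _)) hD
  have hDN : N ≤ D := le_trans (le_trans (le_max_right _ _) (le_max_right _ _)) hD
  have hD3' : (3 : ℝ) ≤ D := by exact_mod_cast hD3
  have hDpos : (0 : ℝ) < D := by linarith
  have hlog1 : 1 < Real.log D := by
    rw [Real.lt_log_iff_exp_lt hDpos]
    linarith [Real.exp_one_lt_d9]
  have hlog : 0 < Real.log D := by linarith
  have hlogbig : η₀ / c₂ < Real.log D := by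
    rw [Real.lt_log_iff_exp_lt hDpos]
    calc Real.exp (η₀ / c₂) < N := hN
      _ ≤ D := by exact_mod_cast hDN
  have hne : χ ≠ 1 := Zhang2022.Skeleton.ne_one_of_isPrimitive_of_three_le hprim hD3
  set θ : ℝ := 1 / (η₀ * Real.log D) with hθ
  have hθpos : 0 < θ := by rw [hθ]; positivity
  have hscale : θ * Real.log D ≤ 1 / η₀ := by
    rw [hθ]; field_simp; rfl
  -- the small value beats the HLP floor: `(log D ^ A)⁻¹ < c₂ θ`
  have hsmall : (Real.log D ^ A)⁻¹ < c₂ * θ := by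
    have hpow : Real.log D ^ 2 ≤ Real.log D ^ A :=
      pow_le_pow_right₀ hlog1.le hA
    have hpos2 : 0 < Real.log D ^ 2 := by positivity
    have hposA : 0 < Real.log D ^ A := by positivity
    have h1 : (Real.log D ^ A)⁻¹ ≤ (Real.log D ^ 2)⁻¹ := by
      rw [inv_le_inv₀ hposA hpos2]; exact hpow
    have h2 : (Real.log D ^ 2)⁻¹ < c₂ * θ := by
      rw [hθ]
      have hc : η₀ < c₂ * Real.log D := by
        rw [div_lt_iff₀ hc₂] at hlogbig; linarith
      have e1 : c₂ * (1 / (η₀ * Real.log D)) = (c₂ / η₀) / Real.log D := by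
        field_simp
      have e2 : (Real.log D ^ 2)⁻¹ = (1 / Real.log D) / Real.log D := by
        rw [pow_two]; field_simp
      rw [e1, e2]
      refine div_lt_div_of_pos_right ?_ hlog
      rw [div_lt_div_iff₀ hlog hη0]
      linarith
    exact lt_of_le_of_lt h1 h2
  -- hence `[1 − θ, 1)` is NOT zero-free
  have hnzf : ¬ ∀ σ : ℝ, 1 - θ ≤ σ → σ < 1 → χ.LFunction σ ≠ 0 := by
    intro hzf
    have key := H D χ hD3 hne θ hθpos hscale hzf
    linarith
  push Not at hnzf
  obtain ⟨σ, hlo, hhi, hzero⟩ := hnzf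
  -- convert the zero `σ` into a Siegel zero of quality `≥ η₀`
  have h1σ : 0 < 1 - σ := by linarith
  set η : ℝ := 1 / ((1 - σ) * Real.log D) with hηdef
  have hηpos : 0 < (1 - σ) * Real.log D := mul_pos h1σ hlog
  have hσeq : 1 - 1 / (η * Real.log D) = σ := by
    rw [hηdef]; field_simp; ring
  have hηge : η₀ ≤ η := by
    rw [hηdef, le_div_iff₀ hηpos]
    have hden : 0 < η₀ * Real.log D := mul_pos hη0 hlog
    have : 1 - σ ≤ 1 / (η₀ * Real.log D) := by rw [hθ] at hlo; linarith
    rw [le_div_iff₀ hden] at this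
    linarith
  refine ⟨D, ‹NeZero D›, χ, η, hDq₀, hηge, hprim, hquad, le_trans hη hηge, ?_⟩
  rw [hσeq]
  exact hzero

end Summit.Parity.GeneralizedHardyLittlewood.Theorems.PrimeLevelFamEdgeIdeaDeltas.Negation

end
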